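import Summits.ResolutionOfSingularities.ResolutionOfSingularities.Theorems.FrobeniusLadderFInjectiveMacaulayficationFHalfRowOfTwoStoreysCharts
import HarnessLib

/-!
# (W-TD) the two-chart formula on the REES CHARTS of an affine blowing up: `(K₀~.map ι_a)|_{D₊(a′t)} = (K₀·R[It]_{(a a′ t²)} ∩ R[It]_{(a′t)})~`
# (crux `FInjectiveMacaulayfication` stmt-ResolutionOfSingularities-15315, chain w45a; res-L1-w45a-plan-1 RULINGS R21.26–R21.30 (row #8 assembly); seat res-L1-w45a-stub-1 g13;
# instance of ✓ p670053 `comap_map_idealSheaf_of_charts` for the charts `affineBlowup.chartι a ha = Proj.awayι (reesT a)` of `affineBlowup I = Proj R[It]`, overlap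
# `Spec R[It]_{(a t · a′ t)}` with Mathlib's `HomogeneousLocalization.awayMap`, `Proj.SpecMap_awayMap_awayι`, `Proj.awayι_preimage_basicOpen`)

[OURS · L1 W4.5a] Support file (`--supports stmt-ResolutionOfSingularities-15315 --as helper`); def-free; UNCONDITIONAL; no named fact; NOT a statement of any manuscript.
Nothing of the crux is proved. AI-written (AI review is weaker than expert review).

* `isOpenImmersion_specMap_awayMap_reesT` — the overlap chart `Spec R[It]_{(at·a′t)} → Spec R[It]_{(at)}` is an open immersion; `specMap_awayMap_comp_chartι` — it commutes
  with the two charts; `opensRange_specMap_awayMap_reesT` — its range is `ι_a⁻¹ ι_{a′}(D₊(a′t))`.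
* ★★ `comap_map_idealSheaf_reesCharts` — for an ideal `K₀ ⊆ R[It]_{(at)}`: `((K₀~).map ι_a).comap ι_{a′} = ((K₀.map τ).comap τ′)~` with `τ, τ′` the two `awayMap`s into
  `R[It]_{(at·a′t)}`.
[cite: GortzWedhorn2020, Prop. 13.91 (2) and (13.19)] [cite: StacksProject, Tag 0804 and Tag 01HQ]
-/

-- single-problem summit: the doubled namespace component is forced
set_option linter.dupNamespace false

noncomputable section

namespace Summit.ResolutionOfSingularities.ResolutionOfSingularities.Theorems.FInjectiveMacaulayfication.FHalfRowOfTwoStoreys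

open CategoryTheory CategoryTheory.Limits AlgebraicGeometry TopologicalSpace IsLocalRing
open Literature.AlgebraicGeometry.Resolution
open Summit.ResolutionOfSingularities.ResolutionOfSingularities.Theorems.FInjectiveMacaulayfication
open SliceableCentre GermOfGlobalBlowup Scheme.IdealSheafData HomogeneousLocalization

universe u

variable {R : Type u} [CommRing R] {I : Ideal R}

/-- The overlap chart commutes with the chart of `a`: `Spec τ ≫ ι_a = ι_{a a′}` (Mathlib `Proj.SpecMap_awayMap_awayι`). [cite: StacksProject, Tag 0804] -/
theorem specMap_awayMap_comp_chartι (a a' : R) (ha : a ∈ I) (ha' : a' ∈ I) :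
    Spec.map (CommRingCat.ofHom (awayMap (reesGrading I) (reesT_mem a' ha') (rfl : reesT a ha * reesT a' ha' = reesT a ha * reesT a' ha'))) ≫
        affineBlowup.chartι (I := I) a ha =
      Proj.awayι (reesGrading I) (reesT a ha * reesT a' ha') (SetLike.mul_mem_graded (reesT_mem a ha) (reesT_mem a' ha')) two_pos := by
  have h := Proj.SpecMap_awayMap_awayι (reesGrading I) (reesT_mem a ha) one_pos (reesT_mem a' ha')
    (rfl : reesT a ha * reesT a' ha' = reesT a ha * reesT a' ha')
  exact h

/-- The overlap chart commutes with the chart of `a′` as well: `Spec τ′ ≫ ι_{a′} = ι_{a a′}`. [cite: StacksProject, Tag 0804] -/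
theorem specMap_awayMap_comp_chartι' (a a' : R) (ha : a ∈ I) (ha' : a' ∈ I) :
    Spec.map (CommRingCat.ofHom (awayMap (reesGrading I) (reesT_mem a ha) (mul_comm (reesT a ha) (reesT a' ha')))) ≫
        affineBlowup.chartι (I := I) a' ha' =
      Proj.awayι (reesGrading I) (reesT a ha * reesT a' ha') (SetLike.mul_mem_graded (reesT_mem a ha) (reesT_mem a' ha')) two_pos := by
  have h := Proj.SpecMap_awayMap_awayι (reesGrading I) (reesT_mem a' ha') one_pos (reesT_mem a ha) (mul_comm (reesT a ha) (reesT a' ha'))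
  exact h

/-- The overlap chart `Spec R[It]_{(at·a′t)} → Spec R[It]_{(at)}` is an open immersion. [cite: StacksProject, Tag 0804] -/
theorem isOpenImmersion_specMap_awayMap_reesT (a a' : R) (ha : a ∈ I) (ha' : a' ∈ I) :
    IsOpenImmersion (Spec.map (CommRingCat.ofHom
      (awayMap (reesGrading I) (reesT_mem a' ha') (rfl : reesT a ha * reesT a' ha' = reesT a ha * reesT a' ha')))) := by
  have : IsOpenImmersion (Spec.map (CommRingCat.ofHom
      (awayMap (reesGrading I) (reesT_mem a' ha') (rfl : reesT a ha * reesT a' ha' = reesT a ha * reesT a' ha'))) ≫ affineBlowup.chartι (I := I) a ha) := by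
    rw [specMap_awayMap_comp_chartι]
    infer_instance
  exact IsOpenImmersion.of_comp _ (affineBlowup.chartι (I := I) a ha)

/-- The range of the overlap chart inside the chart of `a` is the preimage of the chart of `a′`. [cite: StacksProject, Tag 0804] -/
theorem opensRange_specMap_awayMap_reesT (a a' : R) (ha : a ∈ I) (ha' : a' ∈ I) :
    letI := isOpenImmersion_specMap_awayMap_reesT a a' ha ha'
    (Spec.map (CommRingCat.ofHom
      (awayMap (reesGrading I) (reesT_mem a' ha') (rfl : reesT a ha * reesT a' ha' = reesT a ha * reesT a' ha')))).opensRange =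
      affineBlowup.chartι (I := I) a ha ⁻¹ᵁ (affineBlowup.chartι (I := I) a' ha').opensRange := by
  letI := isOpenImmersion_specMap_awayMap_reesT a a' ha ha'
  have hR : affineBlowup.chartι (I := I) a ha ⁻¹ᵁ (affineBlowup.chartι (I := I) a' ha').opensRange =
      PrimeSpectrum.basicOpen (Away.isLocalizationElem (reesT_mem a ha) (reesT_mem a' ha')) := by
    change Proj.awayι (reesGrading I) (reesT a ha) (reesT_mem a ha) one_pos ⁻¹ᵁ
        (Proj.awayι (reesGrading I) (reesT a' ha') (reesT_mem a' ha') one_pos).opensRange = _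
    rw [Proj.opensRange_awayι, Proj.awayι_preimage_basicOpen (reesGrading I) (reesT_mem a ha) one_pos (reesT_mem a' ha') one_pos]
  rw [hR]
  apply TopologicalSpace.Opens.ext
  rw [Scheme.Hom.coe_opensRange]
  letI := (awayMap (f := reesT a ha) (reesGrading I) (reesT_mem a' ha') rfl).toAlgebra
  letI := HomogeneousLocalization.Away.isLocalization_mul (reesT_mem a ha) (reesT_mem a' ha') rfl one_ne_zero
  exact PrimeSpectrum.localization_away_comap_range _ _

/-- ★★ **The two-chart formula on Rees charts.** For `a, a′ ∈ I` and an ideal `K₀` of the chart ring `R[It]_{(at)}` of `Bl_I Spec R`: the largest extension of `K₀~`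
from the chart `D₊(at)`, restricted to the chart `D₊(a′t)`, is the ideal sheaf of `(K₀·R[It]_{(at·a′t)}) ∩ R[It]_{(a′t)}` (contraction along Mathlib's `awayMap`s).
[cite: GortzWedhorn2020, Prop. 13.91 (2)] [cite: StacksProject, Tag 0804] -/
theorem comap_map_idealSheaf_reesCharts [IsNoetherianRing R] (a a' : R) (ha : a ∈ I) (ha' : a' ∈ I)
    (K₀ : Ideal (Away (reesGrading I) (reesT a ha))) :
    ((affineBlowup.idealSheaf K₀).map (affineBlowup.chartι (I := I) a ha)).comap (affineBlowup.chartι (I := I) a' ha') =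
      affineBlowup.idealSheaf ((K₀.map (awayMap (reesGrading I) (reesT_mem a' ha') (rfl : reesT a ha * reesT a' ha' = reesT a ha * reesT a' ha'))).comap
        (awayMap (reesGrading I) (reesT_mem a ha) (mul_comm (reesT a ha) (reesT a' ha')))) := by
  letI := isOpenImmersion_specMap_awayMap_reesT a a' ha ha'
  refine comap_map_idealSheaf_of_charts (affineBlowup.chartι (I := I) a ha) (affineBlowup.chartι (I := I) a' ha') _ _ ?_ ?_ K₀
  · rw [specMap_awayMap_comp_chartι, specMap_awayMap_comp_chartι']
  · exact opensRange_specMap_awayMap_reesT a a' ha ha'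

end Summit.ResolutionOfSingularities.ResolutionOfSingularities.Theorems.FInjectiveMacaulayfication.FHalfRowOfTwoStoreys

end
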